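import Summits.BirchSwinnertonDyer.BirchSwinnertonDyer.Theorems.GenusKolyvaginAtTwoTorsionCellSELNegTwistFrame
import Summits.BirchSwinnertonDyer.BirchSwinnertonDyer.Theorems.GenusKolyvaginAtTwoTorsionCellSELRelaxedOnePrime
import Literature.NumberTheory.EllipticCurves.TwoDescentRankZeroSelmerFullTwoTorsion
import HarnessLib

/-!
# SEL (iso-class Selmer pair law), C1-H: EVEN relaxed classes are torsion times explicit classes (R_S = torsion)

Crux R″ `RankOneTwoTorsionResidualAtTwo` (stmt-27478), LINE 49 «full_vertex», SUPPORT stub SEL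
`IsoClassSelmerPairLawAtTwo`, the `C₁` half (LEAD memo `Cruxes/…/Lines/torsion_cell_full_vertex_SEL_C1_road_g36.md`,
§2 (R1)–(R2)).  Setting: `E/ℚ` with rational `2`-torsion `e₁ < e₂ < e₃`, rank `0`, `Ш(E)[2] = 0`, good reduction and
unit root differences off `S ∋ 2`; `Q` an iso-class set of full-admissible primes `≡ 3 (mod 4)` (`δ₁, δ₂` non-residues,
common bit `ε`) disjoint from `S`; `p₀ ≡ 7 (mod 8)` outside `S` with `(−p₀/ℓ) = 1` for odd `ℓ ∈ S`.

**`kernel_eq_torsion_of_relaxed_even`** — if the E-class of the pair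
`(m_a · X_a · ∏_{i∈Q_a} i, m_b · X_b · ∏_{i∈Q_b} i)` with `m_a, m_b` non-zero `S`-supported integers, `X_a, X_b ∈ {1, −p₀}`
and EVEN sub-products `Q_a, Q_b ⊆ Q` satisfies `E`'s local Selmer condition at every prime of `S` (a RELAXED class),
then `([m_a], [m_b])` is one of the four torsion pairs `(1,1), (δ₁, e₁−e₂), (e₂−e₁, δ₂), (e₃−e₁, e₃−e₂)` of `E`.
Proof: strip the explicit part (squares at `S`), get an `S`-unit relaxed class; it is POSITIVE by the reciprocity lemma
`pos_of_relaxed_pair` (pairing with `κ(T₁)`; no Poitou–Tate), hence Selmer (`…D0ParityFrame.mem_selmerGroup_iff_frame`),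
hence torsion (residue kernel at a prime of `Q`, `eq_zero_of_mem_selmerGroup_of_qrBit_eq_zero`).

Everything is proved; no LINE 49 statement is restated; BSD is not advanced by this file alone.

## References

* [SilvermanAEC2009] J. H. Silverman, *The Arithmetic of Elliptic Curves*, 2nd ed., Prop. X.1.4, Thm. X.4.2, Prop. X.4.9.
* [KlagsbrunMazurRubin2013] Z. Klagsbrun, B. Mazur, K. Rubin, Ann. of Math. 178 (2013), Def. 3.8, Thm. 3.9.
* [Kane2013SelmerTwists] D. M. Kane, Algebra Number Theory 7 (2013), §2.
-/

noncomputable section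

open scoped Classical

namespace Summit.BirchSwinnertonDyer.BirchSwinnertonDyer.Theorems.GenusKolyvaginAtTwo.TorsionCellSEL

open WeierstrassCurve WeierstrassCurve.Affine WeierstrassCurve.Affine.Point
open Literature.NumberTheory.GaloisRepresentations Literature.NumberTheory.EllipticCurves Field
open Literature.NumberTheory.EllipticCurves.TwoDescentLocal
open Literature.NumberTheory.EllipticCurves.KramerTwoDescent
open Literature.NumberTheory.QuadraticForms
open Summit.BirchSwinnertonDyer.BirchSwinnertonDyer.Theorems.GenusKolyvaginAtTwo.TorsionCellD0
open IsDedekindDomain NumberField Rat.HeightOneSpectrum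

/-! ## Small facts -/

/-- `𝔽₂` arithmetic: `1 + ε + x = 1 ⟹ x = ε`. [folklore] -/
private theorem zmod2_solve₁' (ε x : ZMod 2) (h : 1 + ε + x = 1) : x = ε := by revert ε x; decide

/-- `𝔽₂` arithmetic: `ε + x = 1 ⟹ x = 1 + ε`. [folklore] -/
private theorem zmod2_solve₂' (ε x : ZMod 2) (h : ε + x = 1) : x = 1 + ε := by revert ε x; decide

/-- `𝔽₂` arithmetic: `1 + (1 + ε) = ε`. [folklore] -/
private theorem zmod2_solve₃' (ε : ZMod 2) : 1 + (1 + ε) = ε := by revert ε; decide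

/-- In `ℚˣ/ℚˣ²` every class is its own inverse: `[x·t] = 1 ⟹ [x] = [t]`. [folklore] -/
private theorem mk_eq_of_mk_mul_eq_one' {x t : ℚˣ} (h : (QuotientGroup.mk (x * t) : SqUnits ℚ) = 1) :
    (QuotientGroup.mk x : SqUnits ℚ) = QuotientGroup.mk t := by
  rw [QuotientGroup.mk_mul] at h
  calc (QuotientGroup.mk x : SqUnits ℚ)
      = QuotientGroup.mk x * (QuotientGroup.mk t * QuotientGroup.mk t) := by rw [SqUnits.mul_self, mul_one]
    _ = (QuotientGroup.mk x * QuotientGroup.mk t) * QuotientGroup.mk t := by rw [mul_assoc]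
    _ = QuotientGroup.mk t := by rw [h, one_mul]

/-- The components of the zero class are trivial. [cite: SilvermanAEC2009, Prop. X.1.4] -/
private theorem mk_eq_one_of_eq_zero' {W : WeierstrassCurve ℚ} [W.IsElliptic] {a₁ a₂ a₃ : ℚ}
    (h : W.toAffine.SplitTwoTorsion a₁ a₂ a₃) {c : galH1Torsion W 2} (hc : c = 0) {x : ℚˣ}
    (hx : kummerEquiv ℚ 2 (W.twoTorsionCharH1 h c) = Additive.ofMul (QuotientGroup.mk x)) :
    (QuotientGroup.mk x : SqUnits ℚ) = 1 := by
  subst hc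
  rw [_root_.map_zero, _root_.map_zero] at hx
  exact Additive.ofMul.injective (hx.symm.trans ofMul_one.symm)

/-- An `S`-supported integer has parity `0` at a prime outside `S`. [folklore] -/
private theorem parityBit_intCast_eq_zero {ℓ : ℕ} [Fact ℓ.Prime] {m : ℤ} (hm : ¬ (ℓ : ℤ) ∣ m) :
    parityBit ℓ (m : ℚ) = 0 := by
  rw [parityBit, padicValRat.of_int, padicValInt.eq_zero_of_not_dvd hm]
  rfl

variable (E : WeierstrassCurve ℚ) [E.IsElliptic] {e₁ e₂ e₃ : ℚ} (S Q : Finset ℕ) {p₀ : ℕ} [hp₀ : Fact p₀.Prime]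

/-! ## Even relaxed classes -/

/-- **EVEN RELAXED CLASSES ARE TORSION TIMES EXPLICIT CLASSES.**  See the module docstring.
[cite: SilvermanAEC2009, Prop. X.1.4, Thm. X.4.2, Prop. X.4.9] [cite: KlagsbrunMazurRubin2013, Thm. 3.9]
[cite: Kane2013SelmerTwists, §2] -/
theorem kernel_eq_torsion_of_relaxed_even (h : E.toAffine.SplitTwoTorsion e₁ e₂ e₃) (h12 : e₁ < e₂) (h23 : e₂ < e₃)
    (h2S : 2 ∈ S)
    (hgood : ∀ ℓ : ℕ, (hℓ : ℓ.Prime) → ℓ ∉ S → haveI : Fact ℓ.Prime := ⟨hℓ⟩;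
      padicValRat ℓ (e₁ - e₂) = 0 ∧ padicValRat ℓ (e₁ - e₃) = 0 ∧ padicValRat ℓ (e₂ - e₃) = 0)
    (hN : ∀ ℓ : ℕ, ℓ.Prime → ℓ ∉ S → ¬ ℓ ∣ E.conductorNorm ℤ)
    (hrank : E.mordellWeilRank = 0) (hsha : ∀ x ∈ E.sha, (2 : ℕ) • x = 0 → x = 0)
    (hQ : ∀ q ∈ Q, q.Prime) (hQS : ∀ q ∈ Q, q ∉ S) (hQ4 : ∀ q ∈ Q, q % 4 = 3)
    {q₀ : ℕ} (hq₀ : q₀ ∈ Q)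
    (hiso8 : ∀ q ∈ Q, ∀ q' ∈ Q, q % 8 = q' % 8)
    (hisoS : ∀ q ∈ Q, ∀ q' ∈ Q, ∀ ℓ ∈ S, (hℓ : ℓ.Prime) → ℓ ≠ 2 → haveI : Fact ℓ.Prime := ⟨hℓ⟩;
      legendreSym ℓ ((q : ℤ) * q') = 1)
    (hadm : ∀ q ∈ Q, (hq : q.Prime) → haveI : Fact q.Prime := ⟨hq⟩;
      qrBit q ((e₁ - e₂) * (e₁ - e₃)) = 1 ∧ qrBit q ((e₂ - e₁) * (e₂ - e₃)) = 1)
    {ε : ZMod 2} (hε : ∀ q ∈ Q, (hq : q.Prime) → haveI : Fact q.Prime := ⟨hq⟩; qrBit q (e₂ - e₁) = ε)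
    (hp₀S : p₀ ∉ S) (hp8 : p₀ % 8 = 7)
    (hsplitp : ∀ ℓ ∈ S, (hℓ : ℓ.Prime) → ℓ ≠ 2 → haveI : Fact ℓ.Prime := ⟨hℓ⟩; legendreSym ℓ (-(p₀ : ℤ)) = 1)
    {ma mb : ℤ} (hma0 : (ma : ℚ) ≠ 0) (hmb0 : (mb : ℚ) ≠ 0) (hmadiv : ∀ ℓ : ℕ, ℓ.Prime → ℓ ∉ S → ¬ (ℓ : ℤ) ∣ ma)
    (hmbdiv : ∀ ℓ : ℕ, ℓ.Prime → ℓ ∉ S → ¬ (ℓ : ℤ) ∣ mb)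
    {Xa Xb : ℚ} (hXa : Xa = 1 ∨ Xa = -(p₀ : ℚ)) (hXb : Xb = 1 ∨ Xb = -(p₀ : ℚ))
    {Qa Qb : Finset ℕ} (hQaQ : Qa ⊆ Q) (hQbQ : Qb ⊆ Q) (hQae : Even Qa.card) (hQbe : Even Qb.card)
    (hA0 : (ma : ℚ) * Xa * ∏ i ∈ Qa, (i : ℚ) ≠ 0) (hB0 : (mb : ℚ) * Xb * ∏ i ∈ Qb, (i : ℚ) ≠ 0)
    (hloc : ∀ v : HeightOneSpectrum (𝓞 ℚ), natGenerator v ∈ S →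
      E.twoDescentClass h (Units.mk0 _ hA0) (Units.mk0 _ hB0) ∈ selmerLocalKer E (v.adicCompletion ℚ) 2) :
    ∃ (t₁ t₂ : ℚˣ),
      (((t₁ : ℚ) = 1 ∧ (t₂ : ℚ) = 1) ∨ ((t₁ : ℚ) = (e₁ - e₂) * (e₁ - e₃) ∧ (t₂ : ℚ) = e₁ - e₂) ∨
        ((t₁ : ℚ) = e₂ - e₁ ∧ (t₂ : ℚ) = (e₂ - e₁) * (e₂ - e₃)) ∨ ((t₁ : ℚ) = e₃ - e₁ ∧ (t₂ : ℚ) = e₃ - e₂)) ∧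
      (QuotientGroup.mk (Units.mk0 (ma : ℚ) hma0) : SqUnits ℚ) = QuotientGroup.mk t₁ ∧
        (QuotientGroup.mk (Units.mk0 (mb : ℚ) hmb0) : SqUnits ℚ) = QuotientGroup.mk t₂ := by
  haveI hq₀F : Fact q₀.Prime := ⟨hQ q₀ hq₀⟩
  have hQ0 : ∀ q ∈ Q, (q : ℚ) ≠ 0 := fun q hq => by exact_mod_cast (hQ q hq).ne_zero
  have hpa0 : ∏ i ∈ Qa, (i : ℚ) ≠ 0 := Finset.prod_ne_zero_iff.mpr fun i hi => hQ0 i (hQaQ hi)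
  have hpb0 : ∏ i ∈ Qb, (i : ℚ) ≠ 0 := Finset.prod_ne_zero_iff.mpr fun i hi => hQ0 i (hQbQ hi)
  have hp0 : (p₀ : ℚ) ≠ 0 := by exact_mod_cast hp₀.out.ne_zero
  have hXa0 : Xa ≠ 0 := by rcases hXa with e | e <;> rw [e]; exacts [one_ne_zero, neg_ne_zero.mpr hp0]
  have hXb0 : Xb ≠ 0 := by rcases hXb with e | e <;> rw [e]; exacts [one_ne_zero, neg_ne_zero.mpr hp0]
  have he12 : e₁ - e₂ ≠ 0 := sub_ne_zero.mpr h.ne₁₂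
  have he21 : e₂ - e₁ ≠ 0 := sub_ne_zero.mpr h.ne₁₂.symm
  have he13 : e₁ - e₃ ≠ 0 := sub_ne_zero.mpr h.ne₁₃
  have he31 : e₃ - e₁ ≠ 0 := sub_ne_zero.mpr h.ne₁₃.symm
  have he23 : e₂ - e₃ ≠ 0 := sub_ne_zero.mpr h.ne₂₃
  have he32 : e₃ - e₂ ≠ 0 := sub_ne_zero.mpr h.ne₂₃.symm
  -- the explicit part is a square at every place of `S`
  have hsqX : ∀ {X : ℚ}, (X = 1 ∨ X = -(p₀ : ℚ)) → ∀ v : HeightOneSpectrum (𝓞 ℚ), natGenerator v ∈ S →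
      IsSquare (algebraMap ℚ (v.adicCompletion ℚ) X) := by
    intro X hX v hvS
    rcases hX with e | e
    · rw [e, map_one]; exact IsSquare.one
    · rw [e]
      by_cases hv2 : (primesEquiv v : ℕ) = 2
      · exact isSquare_neg_prime_adicCompletion_two (p := p₀) hp8 v hv2
      · haveI : Fact (primesEquiv v : ℕ).Prime := ⟨(primesEquiv v).2⟩
        have hℓp : (primesEquiv v : ℕ) ≠ p₀ := fun e' => hp₀S (e' ▸ hvS)
        exact isSquare_neg_prime_adicCompletion_odd (p := p₀) v rfl hv2 hℓp (hsplitp _ hvS (primesEquiv v).2 hv2)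
  have hgloc : ∀ v : HeightOneSpectrum (𝓞 ℚ), natGenerator v ∈ S →
      E.twoDescentClass h (Units.mk0 _ (mul_ne_zero hXa0 hpa0)) (Units.mk0 _ (mul_ne_zero hXb0 hpb0)) ∈
        selmerLocalKer E (v.adicCompletion ℚ) 2 := by
    intro v hvS
    refine twoDescentClass_mem_selmerLocalKer_of_isSquare E h _ (charZero_of_injective_algebraMap (algebraMap ℚ _).injective)
      _ _ ?_ ?_
    · rw [Units.val_mk0, map_mul]
      exact (hsqX hXa v hvS).mul (isSquare_prod_adicCompletion_of_isoClass S Q hQ hQS hQ4 hiso8 hisoS hQaQ hQae v hvS)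
    · rw [Units.val_mk0, map_mul]
      exact (hsqX hXb v hvS).mul (isSquare_prod_adicCompletion_of_isoClass S Q hQ hQS hQ4 hiso8 hisoS hQbQ hQbe v hvS)
  -- the stripped class `y = c_E(m_a, m_b)` is relaxed at `S`
  have hsplit : E.twoDescentClass h (Units.mk0 _ hA0) (Units.mk0 _ hB0) =
      E.twoDescentClass h (Units.mk0 (ma : ℚ) hma0) (Units.mk0 (mb : ℚ) hmb0) +
        E.twoDescentClass h (Units.mk0 _ (mul_ne_zero hXa0 hpa0)) (Units.mk0 _ (mul_ne_zero hXb0 hpb0)) := by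
    rw [← twoDescentClass_mul]
    congr 1 <;> exact Units.ext (by simp [mul_assoc])
  have hyloc : ∀ v : HeightOneSpectrum (𝓞 ℚ), natGenerator v ∈ S →
      E.twoDescentClass h (Units.mk0 (ma : ℚ) hma0) (Units.mk0 (mb : ℚ) hmb0) ∈ selmerLocalKer E (v.adicCompletion ℚ) 2 := by
    intro v hvS
    have := sub_mem (hloc v hvS) (hgloc v hvS)
    rwa [hsplit, add_sub_cancel_right] at this
  -- `y + κ(T₁)` is relaxed too
  have hT₁ : E.twoDescentClass h (Units.mk0 _ (mul_ne_zero he12 he13)) (Units.mk0 _ he12) ∈ E.selmerGroup 2 :=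
    twoDescentClass_mem_selmerGroup_T₁ E h _ _ rfl rfl
  have hy'loc : ∀ v : HeightOneSpectrum (𝓞 ℚ), natGenerator v ∈ S →
      E.twoDescentClass h (Units.mk0 (ma : ℚ) hma0 * Units.mk0 _ (mul_ne_zero he12 he13))
        (Units.mk0 (mb : ℚ) hmb0 * Units.mk0 _ he12) ∈ selmerLocalKer E (v.adicCompletion ℚ) 2 := by
    intro v hvS
    rw [twoDescentClass_mul]
    exact add_mem (hyloc v hvS) (((mem_selmerGroup_iff _ _ _).mp hT₁).1 v)
  -- parities off `S`
  have hsuppm : ∀ ℓ : ℕ, (hℓ : ℓ.Prime) → ℓ ∉ S → haveI : Fact ℓ.Prime := ⟨hℓ⟩;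
      parityBit ℓ ((Units.mk0 (ma : ℚ) hma0 : ℚˣ) : ℚ) = 0 ∧ parityBit ℓ ((Units.mk0 (mb : ℚ) hmb0 : ℚˣ) : ℚ) = 0 := by
    intro ℓ hℓ hℓS
    haveI : Fact ℓ.Prime := ⟨hℓ⟩
    rw [Units.val_mk0, Units.val_mk0]
    exact ⟨parityBit_intCast_eq_zero (hmadiv ℓ hℓ hℓS), parityBit_intCast_eq_zero (hmbdiv ℓ hℓ hℓS)⟩
  have hsuppm' : ∀ ℓ : ℕ, (hℓ : ℓ.Prime) → ℓ ∉ S → haveI : Fact ℓ.Prime := ⟨hℓ⟩;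
      parityBit ℓ ((Units.mk0 (ma : ℚ) hma0 * Units.mk0 _ (mul_ne_zero he12 he13) : ℚˣ) : ℚ) = 0 ∧
        parityBit ℓ ((Units.mk0 (mb : ℚ) hmb0 * Units.mk0 _ he12 : ℚˣ) : ℚ) = 0 := by
    intro ℓ hℓ hℓS
    haveI : Fact ℓ.Prime := ⟨hℓ⟩
    obtain ⟨g12, g13, -⟩ := hgood ℓ hℓ hℓS
    rw [Units.val_mul, Units.val_mul, Units.val_mk0, Units.val_mk0, Units.val_mk0, Units.val_mk0,
      parityBit_mul hma0 (mul_ne_zero he12 he13), parityBit_mul hmb0 he12, parityBit_mul he12 he13,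
      parityBit_intCast_eq_zero (hmadiv ℓ hℓ hℓS), parityBit_intCast_eq_zero (hmbdiv ℓ hℓ hℓS)]
    simp [parityBit, g12, g13]
  -- POSITIVITY of `m_a` by the reciprocity lemma
  have hpos : 0 < ((Units.mk0 (ma : ℚ) hma0 : ℚˣ) : ℚ) :=
    pos_of_relaxed_pair E S h h12 h23 h2S hgood _ _ _ _
      (E.kummerEquiv_twoTorsionCharH1_twoDescentClass h _ _) (E.kummerEquiv_twoTorsionCharH1_swap_twoDescentClass h _ _)
      (E.kummerEquiv_twoTorsionCharH1_twoDescentClass h _ _) (E.kummerEquiv_twoTorsionCharH1_swap_twoDescentClass h _ _)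
      (by rw [Units.val_mul, Units.val_mk0, Units.val_mk0]) (by rw [Units.val_mul, Units.val_mk0, Units.val_mk0])
      hsuppm hsuppm' hyloc hy'loc
  -- hence `y ∈ Sel⁽²⁾(E)`
  have hy : E.twoDescentClass h (Units.mk0 (ma : ℚ) hma0) (Units.mk0 (mb : ℚ) hmb0) ∈ E.selmerGroup 2 :=
    (mem_selmerGroup_iff_frame E S h h2S h12 h23 hgood hN _ _ (E.kummerEquiv_twoTorsionCharH1_twoDescentClass h _ _)
      (E.kummerEquiv_twoTorsionCharH1_swap_twoDescentClass h _ _)).mpr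
      ⟨hsuppm, hyloc, (signBit_eq_zero_iff hma0).mpr hpos⟩
  -- residue bits of the torsion values at `q₀`
  have hm1 : qrBit q₀ (-1 : ℚ) = 1 := qrBit_neg_one_eq_one_of_emod_four (hQ4 q₀ hq₀)
  obtain ⟨hδ₁, hδ₂⟩ := hadm q₀ hq₀ hq₀F.out
  have hε₀ := hε q₀ hq₀ hq₀F.out
  have hq12 : qrBit q₀ (e₁ - e₂) = 1 + ε := by rw [← neg_sub, qrBit_neg (p := q₀) he21, hm1, hε₀]
  have hq31 : qrBit q₀ (e₃ - e₁) = 1 + ε := by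
    have h1 : qrBit q₀ (e₁ - e₃) = ε := by
      have := hδ₁; rw [qrBit_mul q₀ he12 he13, hq12] at this
      exact zmod2_solve₁' ε _ this
    rw [← neg_sub, qrBit_neg (p := q₀) he13, hm1, h1]
  have hq32 : qrBit q₀ (e₃ - e₂) = ε := by
    have h1 : qrBit q₀ (e₂ - e₃) = 1 + ε := by
      have := hδ₂; rw [qrBit_mul q₀ he21 he23, hε₀] at this
      exact zmod2_solve₂' ε _ this
    rw [← neg_sub, qrBit_neg (p := q₀) he23, hm1, h1, zmod2_solve₃']
  -- generic step: a Selmer torsion class `t` whose bits at `q₀` match those of `y` forces `[m] = [t]`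
  have key : ∀ (t₁ t₂ : ℚˣ), E.twoDescentClass h t₁ t₂ ∈ E.selmerGroup 2 →
      qrBit q₀ (t₁ : ℚ) = qrBit q₀ (ma : ℚ) → qrBit q₀ (t₂ : ℚ) = qrBit q₀ (mb : ℚ) →
      (QuotientGroup.mk (Units.mk0 (ma : ℚ) hma0) : SqUnits ℚ) = QuotientGroup.mk t₁ ∧
        (QuotientGroup.mk (Units.mk0 (mb : ℚ) hmb0) : SqUnits ℚ) = QuotientGroup.mk t₂ := by
    intro t₁ t₂ ht hr₁ hr₂
    have hsum := add_mem hy ht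
    rw [← twoDescentClass_mul] at hsum
    have hz := E.eq_zero_of_mem_selmerGroup_of_qrBit_eq_zero h hrank hsha hm1 hδ₁ hδ₂ hsum _ _
      (E.kummerEquiv_twoTorsionCharH1_twoDescentClass h _ _) (E.kummerEquiv_twoTorsionCharH1_swap_twoDescentClass h _ _)
      (by rw [Units.val_mul, Units.val_mk0, qrBit_mul q₀ hma0 t₁.ne_zero, hr₁, CharTwo.add_self_eq_zero])
      (by rw [Units.val_mul, Units.val_mk0, qrBit_mul q₀ hmb0 t₂.ne_zero, hr₂, CharTwo.add_self_eq_zero])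
    exact ⟨mk_eq_of_mk_mul_eq_one' (mk_eq_one_of_eq_zero' h hz (E.kummerEquiv_twoTorsionCharH1_twoDescentClass h _ _)),
      mk_eq_of_mk_mul_eq_one' (mk_eq_one_of_eq_zero' h.swap₁₂ hz (E.kummerEquiv_twoTorsionCharH1_swap_twoDescentClass h _ _))⟩
  -- the trivial class `c(1,1) = 0` is Selmer
  have hO : E.twoDescentClass h 1 1 ∈ E.selmerGroup 2 := by
    rw [← E.eq_twoDescentClass_of_kummerEquiv_eq h 1 1 (c := 0)
      (by rw [_root_.map_zero, _root_.map_zero, QuotientGroup.mk_one, ofMul_one])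
      (by rw [_root_.map_zero, _root_.map_zero, QuotientGroup.mk_one, ofMul_one])]
    exact zero_mem _
  -- the four cases on the bits `(qr_{q₀}(m_a), qr_{q₀}(m_b))`
  have hz2 : ∀ x : ZMod 2, x = 0 ∨ x = 1 := by decide
  rcases hz2 (qrBit q₀ (ma : ℚ)) with ra | ra <;> rcases hz2 (qrBit q₀ (mb : ℚ)) with rb | rb <;>
    rcases hz2 ε with hε0 | hε0 <;> simp only [hε0] at hq12 hq31 hq32 hε₀
  · obtain ⟨h₁, h₂⟩ := key 1 1 hO (by rw [Units.val_one, qrBit_one, ra]) (by rw [Units.val_one, qrBit_one, rb])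
    exact ⟨1, 1, Or.inl ⟨rfl, rfl⟩, h₁, h₂⟩
  · obtain ⟨h₁, h₂⟩ := key 1 1 hO (by rw [Units.val_one, qrBit_one, ra]) (by rw [Units.val_one, qrBit_one, rb])
    exact ⟨1, 1, Or.inl ⟨rfl, rfl⟩, h₁, h₂⟩
  · obtain ⟨h₁, h₂⟩ := key (Units.mk0 _ he21) (Units.mk0 _ (mul_ne_zero he21 he23))
        (twoDescentClass_mem_selmerGroup_T₂ E h _ _ rfl rfl) (by rw [Units.val_mk0, hε₀, ra])
        (by rw [Units.val_mk0, hδ₂, rb])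
    exact ⟨_, _, Or.inr (Or.inr (Or.inl ⟨rfl, rfl⟩)), h₁, h₂⟩
  · obtain ⟨h₁, h₂⟩ := key (Units.mk0 _ he31) (Units.mk0 _ he32)
        (twoDescentClass_mem_selmerGroup_T₃ E h _ _ rfl rfl) (by rw [Units.val_mk0, hq31, ra]; decide)
        (by rw [Units.val_mk0, hq32, rb])
    exact ⟨_, _, Or.inr (Or.inr (Or.inr ⟨rfl, rfl⟩)), h₁, h₂⟩
  · obtain ⟨h₁, h₂⟩ := key (Units.mk0 _ he31) (Units.mk0 _ he32)
        (twoDescentClass_mem_selmerGroup_T₃ E h _ _ rfl rfl) (by rw [Units.val_mk0, hq31, ra]; decide)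
        (by rw [Units.val_mk0, hq32, rb])
    exact ⟨_, _, Or.inr (Or.inr (Or.inr ⟨rfl, rfl⟩)), h₁, h₂⟩
  · obtain ⟨h₁, h₂⟩ := key (Units.mk0 _ (mul_ne_zero he12 he13)) (Units.mk0 _ he12)
        (twoDescentClass_mem_selmerGroup_T₁ E h _ _ rfl rfl) (by rw [Units.val_mk0, hδ₁, ra])
        (by rw [Units.val_mk0, hq12, rb]; decide)
    exact ⟨_, _, Or.inr (Or.inl ⟨rfl, rfl⟩), h₁, h₂⟩
  · obtain ⟨h₁, h₂⟩ := key (Units.mk0 _ (mul_ne_zero he12 he13)) (Units.mk0 _ he12)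
        (twoDescentClass_mem_selmerGroup_T₁ E h _ _ rfl rfl) (by rw [Units.val_mk0, hδ₁, ra])
        (by rw [Units.val_mk0, hq12, rb]; decide)
    exact ⟨_, _, Or.inr (Or.inl ⟨rfl, rfl⟩), h₁, h₂⟩
  · obtain ⟨h₁, h₂⟩ := key (Units.mk0 _ he21) (Units.mk0 _ (mul_ne_zero he21 he23))
        (twoDescentClass_mem_selmerGroup_T₂ E h _ _ rfl rfl) (by rw [Units.val_mk0, hε₀, ra])
        (by rw [Units.val_mk0, hδ₂, rb])
    exact ⟨_, _, Or.inr (Or.inr (Or.inl ⟨rfl, rfl⟩)), h₁, h₂⟩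

end Summit.BirchSwinnertonDyer.BirchSwinnertonDyer.Theorems.GenusKolyvaginAtTwo.TorsionCellSEL

end
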